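import Literature.Geometry.Kaehler.ComplexTorusAnalyticClassesDescent
import Literature.Geometry.Kaehler.ComplexTorusComplementaryAdditionIsogeny
import Literature.Geometry.Kaehler.ComplexTorusRationalHodgeStructureProduct
import HarnessLib

/-!
# The Hodge `(p,p)`-conjecture in cycle form passes to abelian subvarieties:
# `Aᵖ(X) = H^{2p}_Hodge(X)` ⟹ `Aᵖ(Z) = H^{2p}_Hodge(Z)` for every complex subtorus `Z` of an abelian variety `X`

Layer `Literature/Geometry/Kaehler`, namespace `Literature.Geometry.Kaehler.ComplexTorus`; lane
`lit-hodgefound`, seat p07 (generation 35, file 8), programme «consequences of `D•(X) ⊆ A•(X)` and the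
functoriality of `A•(X)`». Companion of `ComplexTorusAnalyticClassesDescent.lean` (quotients): by
Poincaré's complete reducibility an abelian subvariety `Z ⊆ X` has a complement `K = Z^⊥` with
`μ : Z × K → X` an isogeny (`isIsogenous_prod_subtorus`), so `Aᵖ = B^p := H^{2p}_Hodge` on `X` transports
to `Z × K` (`IsIsogeny.analyticClasses_eq_hodgeClasses_iff`), and a Hodge class `β` of `Z` is recovered
from the Hodge class `pr₁^*β` of `Z × K` by restriction to `Z × 0` (`i₀^* pr₁^* = id`), which preserves
analytic classes (`comp_realRep_inlMatrix_mem_analyticClasses`).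

* §1 `realRep_fstMatrix_prodPeriodL2` (`ρ_a(pr₁) = fst ∘ P` on the Euclidean product) and
  `comp_realRep_fstMatrix_mem_hodgeClasses` (`pr₁^* B^p(X₁) ⊆ B^p(X₁ × X₂)`, Euclidean product).
* §2 **`IsRiemannForm.analyticClasses_subtorus_eq_hodgeClasses`** / `IsAbelianVariety.…`: `Aᵖ(X) = B^p(X)`
  ⟹ `Aᵖ(Z) = B^p(Z)` for every complex subtorus `Z` of a polarised abelian variety `X` (and every
  enumeration of the lattice basis of `Z`).

Theorems only; no definitions, no named facts.

## References

* [Lange2023AbelianVarietiesComplex] H. Lange, *Abelian Varieties over the Complex Numbers*, Springer 2023,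
  §2.4.4 Thm. 2.4.23, Cor. 2.4.24 (Poincaré's complete reducibility), §7.3.3 Exercise (1) (p. 341).
* [SwinnertonDyer1974AbelianVarieties] H. P. F. Swinnerton-Dyer, *Analytic Theory of Abelian Varieties*,
  CUP 1974, Ch. II §7 Thm. 34 and Cor. 3 (pp. 55–58).
* [Fulton1998] W. Fulton, *Intersection Theory*, 2nd ed., Springer 1998, §19.2 Cor. 19.2 (b).
-/

noncomputable section

open scoped Manifold Topology
open MeasureTheory Set Function Module WithLp

universe u

namespace Literature.Geometry.Kaehler

namespace ComplexTorus

/-! ### §1 `pr₁^*` of Hodge classes on the Euclidean product -/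

section Fst

variable {ι₁ ι₂ : Type*} [Fintype ι₁] [Fintype ι₂] [DecidableEq ι₁] [DecidableEq ι₂]
  {E₁ : Type*} [NormedAddCommGroup E₁] [InnerProductSpace ℂ E₁]
  {E₂ : Type*} [NormedAddCommGroup E₂] [InnerProductSpace ℂ E₂]
  (Φ₁ : (ι₁ → ℝ) ≃L[ℝ] E₁) (Φ₂ : (ι₂ → ℝ) ≃L[ℝ] E₂)

omit [DecidableEq ι₂] in
/-- **`ρ_a(pr₁) = fst ∘ P`** on the Euclidean product torus (`P : WithLp 2 (E₁ × E₂) ≃ E₁ × E₂`).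
[cite: Lange2023AbelianVarietiesComplex, §1.1.2 (p. 20)] -/
theorem realRep_fstMatrix_prodPeriodL2 :
    realRep (prodPeriodL2 Φ₁ Φ₂) Φ₁ (fstMatrix ι₁ ι₂) = (ContinuousLinearMap.fst ℝ E₁ E₂).comp
      (WithLp.prodContinuousLinearEquiv 2 ℝ E₁ E₂ : WithLp 2 (E₁ × E₂) →L[ℝ] E₁ × E₂) := by
  refine ContinuousLinearMap.ext fun w ↦ ?_
  obtain ⟨v, rfl⟩ := (prodPeriodL2 Φ₁ Φ₂).surjective w
  rw [realRep_apply, fstMatrix, Matrix.fromCols_map, Matrix.fromCols_mulVec,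
    Matrix.map_one Int.cast Int.cast_zero Int.cast_one, Matrix.map_zero Int.cast Int.cast_zero,
    Matrix.one_mulVec, Matrix.zero_mulVec, add_zero, prodPeriodL2_apply, prodPeriod_apply]
  rfl

omit [DecidableEq ι₂] in
/-- **`pr₁^* B^p(X₁) ⊆ B^p(X₁ × X₂)`** on the Euclidean product (pull-back of Hodge classes along the
homomorphism `pr₁`, whose analytic representation is `ℂ`-linear).
[cite: Lange2023AbelianVarietiesComplex, §7.3.3 Exercise (1)(a) (p. 341)] -/
theorem comp_realRep_fstMatrix_mem_hodgeClasses {p : ℕ} {β : E₁ [⋀^Fin (2 * p)]→L[ℝ] ℂ}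
    (hβ : β ∈ hodgeClasses Φ₁ p) :
    β.compContinuousLinearMap (realRep (prodPeriodL2 Φ₁ Φ₂) Φ₁ (fstMatrix ι₁ ι₂)) ∈
      hodgeClasses (prodPeriodL2 Φ₁ Φ₂) p := by
  refine comp_realRep_mem_hodgeClassesIn (prodPeriodL2 Φ₁ Φ₂) Φ₁ (fstMatrix ι₁ ι₂) (fun c u ↦ ?_) hβ
  rw [realRep_fstMatrix_prodPeriodL2]
  rfl

end Fst

/-! ### §2 `Aᵖ = B^p` passes to abelian subvarieties -/

section Subtorus

variable {ι : Type*} [Fintype ι] [DecidableEq ι] {E : Type u} [NormedAddCommGroup E] [InnerProductSpace ℂ E]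
  [FiniteDimensional ℂ E] [MeasurableSpace E] [BorelSpace E] (Φ : (ι → ℝ) ≃L[ℝ] E) {n : ℕ} (e : Fin n ≃ ι)
  {η : E [⋀^Fin 2]→L[ℝ] ℝ} {Z : Submodule ℝ (ι → ℝ)} (hZ : IsLatticeSubspace Z) (hZc : IsComplexSubspace Φ Z)
  {nZ : ℕ} (eZ : Fin nZ ≃ Fin (subRank Z)) {p : ℕ}

/-- Private re-association of pull-backs of forms. [folklore] -/
private theorem compContinuousLinearMap_compContinuousLinearMap'' {V W U : Type*} [NormedAddCommGroup V]
    [NormedSpace ℝ V] [NormedAddCommGroup W] [NormedSpace ℝ W] [NormedAddCommGroup U] [NormedSpace ℝ U]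
    {k : ℕ} (γ : U [⋀^Fin k]→L[ℝ] ℂ) (g : W →L[ℝ] U) (f : V →L[ℝ] W) :
    (γ.compContinuousLinearMap g).compContinuousLinearMap f = γ.compContinuousLinearMap (g.comp f) := by
  ext v; rfl

/-- **The Hodge `(p,p)`-conjecture in cycle form passes to abelian subvarieties**: if `Aᵖ(X) = H^{2p}_Hodge(X)`
on a polarised abelian variety `(X, η)`, then `Aᵖ(Z) = H^{2p}_Hodge(Z)` for every complex subtorus `Z` of `X`.
Proof: `μ : Z × Z^⊥ → X` is an isogeny (Poincaré), so `Aᵖ = H^{2p}_Hodge` on `Z × Z^⊥`; for a Hodge class `β`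
of `Z`, `pr₁^*β` is a Hodge, hence analytic, class of `Z × Z^⊥`, and `β = i₀^* pr₁^*β` is analytic.
[cite: Lange2023AbelianVarietiesComplex, §2.4.4 Cor. 2.4.24 and §7.3.3 Exercise (1)(b) (p. 341)]
[cite: SwinnertonDyer1974AbelianVarieties, Ch. II §7 Cor. 3, pp. 57–58] [cite: Fulton1998, §19.2 Cor. 19.2 (b)] -/
theorem IsRiemannForm.analyticClasses_subtorus_eq_hodgeClasses (hη : IsRiemannForm Φ η)
    (h : analyticClasses Φ e p = hodgeClasses Φ p) :
    analyticClasses (subtorusPeriod Φ Z hZ hZc) eZ p = hodgeClasses (subtorusPeriod Φ Z hZ hZc) p := by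
  classical
  obtain ⟨hK, hKc, -⟩ := poincare_reducibility Φ hη hZ hZc
  set K := orthSubspace Φ η Z with hKdef
  -- `μ : Z × K → X` is an isogeny; read it on the Euclidean product
  obtain ⟨A, hA⟩ := (IsIsogenous.trans _ _ _
    ⟨1, isIsogeny_one_prodPeriodL2_prodPeriod (subtorusPeriod Φ Z hZ hZc) (subtorusPeriod Φ K hK hKc)⟩
    (isIsogenous_prod_subtorus Φ hη hZ hZc hK hKc))
  -- ranks: `rk Λ_Z + rk Λ_K = rk Λ`
  have hrk : nZ + subRank K = n := by
    have h1 := finrank_complex_mul_two (subtorusPeriod Φ Z hZ hZc) eZ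
    have h2 := finrank_complex_mul_two (subtorusPeriod Φ K hK hKc) (Equiv.refl (Fin (subRank K)))
    have h3 := finrank_complex_mul_two Φ e
    have h4 := hA.finrank_eq (prodPeriodL2 (subtorusPeriod Φ Z hZ hZc) (subtorusPeriod Φ K hK hKc)) Φ
    have h5 : finrank ℂ (WithLp 2 (↥(cxSpan Φ Z) × ↥(cxSpan Φ K))) =
        finrank ℂ (cxSpan Φ Z) + finrank ℂ (cxSpan Φ K) := by
      rw [(WithLp.prodContinuousLinearEquiv 2 ℂ (cxSpan Φ Z) (cxSpan Φ K)).toLinearEquiv.finrank_eq,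
        Module.finrank_prod]
    omega
  subst hrk
  -- `Aᵖ = H^{2p}_Hodge` on `Z × K`
  have hZK : analyticClasses (prodPeriodL2 (subtorusPeriod Φ Z hZ hZc) (subtorusPeriod Φ K hK hKc))
      (sumEnum eZ (Equiv.refl (Fin (subRank K)))) p =
      hodgeClasses (prodPeriodL2 (subtorusPeriod Φ Z hZ hZc) (subtorusPeriod Φ K hK hKc)) p :=
    (hA.analyticClasses_eq_hodgeClasses_iff _ Φ (sumEnum eZ (Equiv.refl (Fin (subRank K)))) e).2 h
  refine le_antisymm (analyticClasses_le_hodgeClasses _ _ p) fun β hβ ↦ ?_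
  -- `pr₁^*β` is a Hodge class of `Z × K`, hence analytic
  have h1 := comp_realRep_fstMatrix_mem_hodgeClasses (subtorusPeriod Φ Z hZ hZc) (subtorusPeriod Φ K hK hKc) hβ
  rw [← hZK] at h1
  -- restrict to `Z × 0`: `i₀^* pr₁^* = id`
  have h2 := comp_realRep_inlMatrix_mem_analyticClasses (subtorusPeriod Φ Z hZ hZc) (subtorusPeriod Φ K hK hKc)
    eZ (Equiv.refl (Fin (subRank K))) h1
  have hid : β.compContinuousLinearMap (ContinuousLinearMap.id ℝ (cxSpan Φ Z)) = β := by
    ext v; rfl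
  rwa [compContinuousLinearMap_compContinuousLinearMap'', realRep_mul, fstMatrix_mul_inlMatrix, realRep_one,
    hid] at h2

/-- **The Hodge `(p,p)`-conjecture in cycle form passes to abelian subvarieties of an abelian variety.**
[cite: Lange2023AbelianVarietiesComplex, §2.4.4 Cor. 2.4.24 and §7.3.3 Exercise (1)(b) (p. 341)] -/
theorem IsAbelianVariety.analyticClasses_subtorus_eq_hodgeClasses (hX : IsAbelianVariety Φ)
    (h : analyticClasses Φ e p = hodgeClasses Φ p) :
    analyticClasses (subtorusPeriod Φ Z hZ hZc) eZ p = hodgeClasses (subtorusPeriod Φ Z hZ hZc) p := by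
  obtain ⟨η, hη⟩ := hX
  exact hη.analyticClasses_subtorus_eq_hodgeClasses Φ e hZ hZc eZ h

/-- All codimensions: `A• = B•` on `X` ⟹ `A• = B•` on every abelian subvariety.
[cite: Lange2023AbelianVarietiesComplex, §7.3.3 Exercise (1)(b) (p. 341)] -/
theorem IsAbelianVariety.forall_analyticClasses_subtorus_eq_hodgeClasses (hX : IsAbelianVariety Φ)
    (h : ∀ p, analyticClasses Φ e p = hodgeClasses Φ p) (p : ℕ) :
    analyticClasses (subtorusPeriod Φ Z hZ hZc) eZ p = hodgeClasses (subtorusPeriod Φ Z hZ hZc) p :=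
  hX.analyticClasses_subtorus_eq_hodgeClasses Φ e hZ hZc eZ (h p)

end Subtorus

end ComplexTorus

end Literature.Geometry.Kaehler
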